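import Summits.NavierStokesRegularity.NavierStokesRegularity.Theorems.QuarterLogPincerCubicRungDefs
import Summits.NavierStokesRegularity.NavierStokesRegularity.Theses.QuarterLogPincer

/-!
# The crux → R0 edge: `QuarterLogPincer.TypeIQuantSubcubicExp → CubicRung.TypeIQuantCubicExp`

Sorry-free, VERBATIM from `Cruxes/TypeIQuantSubcubicExp/Lines/cubic_rung.lean` v1.1 :137–165 (ns-idea-7; certified
std axioms in ns-afl-r1's audits v5/v6): the rung R0 is literally weaker than the crux
stmt-NavierStokesRegularity-24077 — `o(A³)` at `ε = 1` gives `O(A³)` with `K := 1 + |A₀(1)|³/8`.  Director-ns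
KEY-NS #188 (2): landed BY NAME as a helper; R0 ↛ crux; nothing here proves R0, the crux, or any summit
statement. [folklore]
-/

-- the summit and its single sub-problem share the name (CONVENTIONS §1), as in every Theorems file
set_option linter.dupNamespace false

namespace Summit.NavierStokesRegularity.NavierStokesRegularity.Cruxes.TypeIQuantSubcubicExp.CubicRung

noncomputable section

open MeasureTheory Set
open scoped ENNReal NNReal

/-- `R` is literally weaker than the crux: `o(A³)` at `ε = 1` gives `O(A³)` with
`K := 1 + |A₀(1)|³/8` (monotonicity of the `L³`-history clause in `A`). -/
theorem typeIQuantCubicExp_of_typeIQuantSubcubicExp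
    (h : Summit.NavierStokesRegularity.NavierStokesRegularity.Theses.QuarterLogPincer.TypeIQuantSubcubicExp) :
    TypeIQuantCubicExp := by
  intro M
  obtain ⟨F, hF, hbd⟩ := h M
  obtain ⟨A₀, hA₀⟩ := hF 1 one_pos
  refine ⟨1 + |A₀| ^ 3 / 8, ?_⟩
  intro T τ A u p hframe hτ htypeI hL3 hA t ht x
  -- enlarge the history level to `A' := max A A₀`
  have hAA' : A ≤ max A A₀ := le_max_left _ _
  have hL3' : ∀ s ∈ Icc 0 T, eLpNorm (u s) 3 volume ≤ ENNReal.ofReal (max A A₀) := fun s hs =>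
    (hL3 s hs).trans (ENNReal.ofReal_le_ofReal hAA')
  have hA' : 2 ≤ max A A₀ := hA.trans hAA'
  have hbound := hbd T τ (max A A₀) u p hframe hτ htypeI hL3' hA' t ht x
  have hFle : F (max A A₀) ≤ Real.exp (1 * (max A A₀) ^ 3) := hA₀ _ (le_max_right _ _)
  have hcube : 1 * (max A A₀) ^ 3 ≤ (1 + |A₀| ^ 3 / 8) * A ^ 3 := by
    have hA3 : 8 ≤ A ^ 3 := by
      calc (8 : ℝ) = 2 ^ 3 := by norm_num
        _ ≤ A ^ 3 := by gcongr
    have habs : 0 ≤ |A₀| ^ 3 := by positivity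
    rcases le_total A₀ A with hle | hle
    · rw [max_eq_left hle]
      nlinarith
    · rw [max_eq_right hle]
      have hA₀pos : 0 ≤ A₀ := by linarith
      have h1 : A₀ ^ 3 = |A₀| ^ 3 := by rw [abs_of_nonneg hA₀pos]
      have h2 : |A₀| ^ 3 ≤ |A₀| ^ 3 / 8 * A ^ 3 := by nlinarith
      nlinarith
  have ht0 : 0 ≤ t ^ (-(1 / 2 : ℝ)) := Real.rpow_nonneg ht.1.le _
  calc ‖u t x‖ ≤ F (max A A₀) * t ^ (-(1 / 2 : ℝ)) := hbound
    _ ≤ Real.exp (1 * (max A A₀) ^ 3) * t ^ (-(1 / 2 : ℝ)) := mul_le_mul_of_nonneg_right hFle ht0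
    _ ≤ Real.exp ((1 + |A₀| ^ 3 / 8) * A ^ 3) * t ^ (-(1 / 2 : ℝ)) :=
        mul_le_mul_of_nonneg_right (Real.exp_le_exp.2 hcube) ht0

end

end Summit.NavierStokesRegularity.NavierStokesRegularity.Cruxes.TypeIQuantSubcubicExp.CubicRung
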